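import Mathlib.GroupTheory.Index
import Mathlib.GroupTheory.Coset.Card
import HarnessLib

/-!
# Relative-index bookkeeping for the local index of a Selmer condition (theorems only)

`Proofs` file (THEOREMS ONLY; no definition, no named fact, no instance, no `sorry`) in topic `Algebra/Module`.  Two elementary
counting facts about subgroups of an abelian group, in the `Nat.card (↥F ⧸ C.addSubgroupOf F)` currency of the cell
`pub/bsd-print-x9` letters (`Stmt.readoutLocalIndexP`: «`Finite (↥Fv ⧸ (condA …).addSubgroupOf Fv) ∧ Nat.card (…) ≤ p ^ c`»):

* **`AddSubgroup.finite_and_natCard_quotient_addSubgroupOf_le_mul`** — for `core ≤ F′` and any `C`: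
  `#(F′ ⧸ F′ ∩ C) ≤ #(F′ ⧸ core) · #(core ⧸ core ∩ C)` (with finiteness), i.e. `[F′ : F′ ∩ C] ≤ [F′ : core]·[core : core ∩ C]`
  (Mathlib `relIndex_mul_relIndex`, `relIndex_dvd_of_le_left`).  Use: `F′` = the relaxed local condition, `core` = the strict
  ordinary core, `C` = Howard's saturated condition / `condA`.
* **`AddSubgroup.finite_and_natCard_comap_quotient_le`** — for `f : A →+ B` and `Y, X ≤ B`:
  `#(f⁻¹X ⧸ f⁻¹X ∩ f⁻¹Y) ≤ #(X ⧸ X ∩ Y)` (`f` induces an injection).  Use: the LEVEL SHIFT `f = incLocIter j v e` of the index clause at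
  an anomalous `v ∣ p`.

References: [SerreGaloisCohomology1997] J.-P. Serre, *Local Fields*, Ch. XIII §1 (index bookkeeping); [Howard2004HeegnerKolyvagin]
B. Howard, Compositio Math. 140 (2004), Prop. 2.2.8 and proof of Thm. 2.2.10 (the local indices); [MazurRubinMemoirs2004] Prop. 5.3.14.
BSD is not proved by any of this.
-/

namespace AddSubgroup

universe u v

variable {A : Type u} [AddCommGroup A]

/-- `#(↥F ⧸ C.addSubgroupOf F)` is the relative index `C.relIndex F`. [cite: SerreGaloisCohomology1997, Local Fields Ch. XIII §1] -/
theorem relIndex_eq_natCard_quotient_addSubgroupOf (C F : AddSubgroup A) :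
    C.relIndex F = Nat.card (↥F ⧸ C.addSubgroupOf F) :=
  rfl

/-- **`[F′ : F′ ∩ C] ≤ [F′ : core] · [core : core ∩ C]` for `core ≤ F′`**, with finiteness: if `F′ ⧸ core` and `core ⧸ core ∩ C` are
finite then so is `F′ ⧸ F′ ∩ C` and `#(F′ ⧸ F′ ∩ C) ≤ #(F′ ⧸ core) · #(core ⧸ core ∩ C)`
(`[F′ : C ∩ core] = [F′ : core]·[core : core ∩ C]` and `[F′ : F′ ∩ C] ∣ [F′ : C ∩ core]`).
[cite: SerreGaloisCohomology1997, Local Fields Ch. XIII §1] [cite: Howard2004HeegnerKolyvagin, proof of Thm. 2.2.10 (local indices)] -/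
theorem finite_and_natCard_quotient_addSubgroupOf_le_mul (F' core C : AddSubgroup A) (hcore : core ≤ F')
    [hF : Finite (↥F' ⧸ core.addSubgroupOf F')] [hC : Finite (↥core ⧸ C.addSubgroupOf core)] :
    Finite (↥F' ⧸ C.addSubgroupOf F') ∧
      Nat.card (↥F' ⧸ C.addSubgroupOf F') ≤ Nat.card (↥F' ⧸ core.addSubgroupOf F') * Nat.card (↥core ⧸ C.addSubgroupOf core) := by
  -- in `relIndex` language
  have h1 : core.relIndex F' ≠ 0 := by
    rw [relIndex_eq_natCard_quotient_addSubgroupOf]; exact Nat.card_pos.ne'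
  have h2 : C.relIndex core ≠ 0 := by
    rw [relIndex_eq_natCard_quotient_addSubgroupOf]; exact Nat.card_pos.ne'
  have hmul : (C ⊓ core).relIndex F' = C.relIndex core * core.relIndex F' := by
    rw [← relIndex_mul_relIndex (C ⊓ core) core F' inf_le_right hcore, inf_relIndex_right]
  have hne : (C ⊓ core).relIndex F' ≠ 0 := by rw [hmul]; exact mul_ne_zero h2 h1
  have hle : C.relIndex F' ≤ (C ⊓ core).relIndex F' :=
    relIndex_le_of_le_left (inf_le_left : C ⊓ core ≤ C) hne
  have hCne : C.relIndex F' ≠ 0 := fun h0 ↦ by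
    have := relIndex_dvd_of_le_left F' (inf_le_left : C ⊓ core ≤ C)
    rw [h0, zero_dvd_iff] at this
    exact hne this
  refine ⟨?_, ?_⟩
  · rw [relIndex_eq_natCard_quotient_addSubgroupOf] at hCne
    exact Nat.finite_of_card_ne_zero hCne
  · rw [← relIndex_eq_natCard_quotient_addSubgroupOf, ← relIndex_eq_natCard_quotient_addSubgroupOf,
      ← relIndex_eq_natCard_quotient_addSubgroupOf, mul_comm, ← hmul]
    exact hle

variable {B : Type v} [AddCommGroup B]

/-- **`#(f⁻¹X ⧸ f⁻¹X ∩ f⁻¹Y) ≤ #(X ⧸ X ∩ Y)`** for an additive map `f : A → B` and subgroups `X, Y ≤ B` with `X ⧸ X ∩ Y` finite: `f`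
induces an injection of the quotients.  (The level shift `f = incLocIter` of the index clause at an anomalous place.)
[cite: SerreGaloisCohomology1997, Local Fields Ch. XIII §1] [cite: Howard2004HeegnerKolyvagin, Def. 2.1.1 and proof of Thm. 2.2.10] -/
theorem finite_and_natCard_comap_quotient_le (f : A →+ B) (X Y : AddSubgroup B) [Finite (↥X ⧸ Y.addSubgroupOf X)] :
    Finite (↥(X.comap f) ⧸ (Y.comap f).addSubgroupOf (X.comap f)) ∧
      Nat.card (↥(X.comap f) ⧸ (Y.comap f).addSubgroupOf (X.comap f)) ≤ Nat.card (↥X ⧸ Y.addSubgroupOf X) := by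
  classical
  -- `f` restricted to `f⁻¹X → X`
  let g : ↥(X.comap f) →+ ↥X := (f.comp (X.comap f).subtype).codRestrict X fun a ↦ a.2
  have hg : ∀ a : X.comap f, ((g a : X) : B) = f a := fun _ ↦ rfl
  have hker : (Y.comap f).addSubgroupOf (X.comap f) ≤ (Y.addSubgroupOf X).comap g := by
    intro a ha
    rw [mem_comap, mem_addSubgroupOf, hg]
    exact ha
  let gbar : ↥(X.comap f) ⧸ (Y.comap f).addSubgroupOf (X.comap f) →+ ↥X ⧸ Y.addSubgroupOf X :=
    QuotientAddGroup.map _ _ g hker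
  have hinj : Function.Injective gbar := by
    rw [injective_iff_map_eq_zero]
    intro q hq
    obtain ⟨a, rfl⟩ := QuotientAddGroup.mk_surjective q
    rw [QuotientAddGroup.map_mk, QuotientAddGroup.eq_zero_iff, mem_addSubgroupOf, hg] at hq
    rw [QuotientAddGroup.eq_zero_iff, mem_addSubgroupOf]
    exact hq
  exact ⟨Finite.of_injective gbar hinj, Nat.card_le_card_of_injective gbar hinj⟩

end AddSubgroup
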